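import Literature.Geometry.Symplectic.JPlanePencilFamilyOrientation
import Literature.Geometry.Symplectic.JPlanePencilConstraintIndex
import Mathlib.Analysis.Calculus.FDeriv.Symmetric
import Mathlib.Topology.UniformSpace.HeineCantor
import HarnessLib

/-!
# The overlap comparison for a local pencil family (hypothesis `hG` of universality)

Support theorems (no named facts, D-0026) for
`Literature.Geometry.Symplectic.jPlanePencil_localFamily_homotopySphere`
(`JPlanePencilLocalFamily.lean`; C. Wendl, *Holomorphic Curves in Low Dimensions* (2018),
Prop. 2.53 with `m = 1`, for homotopy 4-spheres).

This file discharges hypothesis `hG` of `IsPencilPlane.eq_of_localFamily`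
(`JPlanePencilUniversality.lean`) from the smoothness of the family across the constraint
point (`ContDiffOn ℝ ∞ (famXW p Floc)` about `(b, 0)`, cf. `JPlanePencilFamilyOrientation.lean`):
on small far circles the defining function `π_p` of the cap of `L = Floc b`, evaluated on the
member `Floc b'`, equals `(b' − b) Λ` with `Re Λ > 0`. By the exact factorisation
`π_p (cap_{b'} η) = σ_{b'}(η) (W_{b'}(η) − Ŵ_L(σ_{b'}(η)))` (`capDefFn_pencilCap_eq`) this is a
first-order Taylor statement in `b'` at fixed small `η`, uniform in `η`: the `w`-coordinate at
infinity moves with unit speed in `b'` (`famW (b', 0) = b'`), while the coordinate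
`x' = capX` moves only to second order (`capX (b', 0) = 0`, `∂_η capX (b', 0) = 1` for all `b'`,
whence `∂_{b'} capX = o(η)` by the symmetry of second derivatives).

## References

* C. Wendl, *Holomorphic Curves in Low Dimensions*, LNM 2216, Springer (2018), Prop. 2.53,
  Thm. 2.46. [Wendl2018]
-/

noncomputable section

open scoped Manifold ContDiff Topology ComplexConjugate
open Set Function Filter Metric Complex

namespace Literature.Geometry.Symplectic

/-! ### §1 Two calculus lemmas -/

section Calculus

variable {E : Type*} [NormedAddCommGroup E] [NormedSpace ℝ E]

/-- **Mean value estimate along a complex segment from `0`**: if `f` is differentiable on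
`ball 0 R` with `‖fderiv f x − φ‖ ≤ C` there, then `‖f η − f 0 − φ η‖ ≤ C ‖η‖` on the ball.
[folklore] -/
theorem norm_sub_sub_le_of_fderiv_ball {f : ℂ → E} {φ : ℂ →L[ℝ] E} {R C : ℝ} {η : ℂ}
    (hf : ∀ x ∈ ball (0 : ℂ) R, DifferentiableAt ℝ f x)
    (hb : ∀ x ∈ ball (0 : ℂ) R, ‖fderiv ℝ f x - φ‖ ≤ C) (hη : η ∈ ball (0 : ℂ) R) :
    ‖f η - f 0 - φ η‖ ≤ C * ‖η‖ := by
  have h := (convex_ball (0 : ℂ) R).norm_image_sub_le_of_norm_fderiv_le' hf hb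
    (mem_ball_self (lt_of_le_of_lt (norm_nonneg η) (mem_ball_zero_iff.1 hη))) hη
  simpa using h

/-- **Uniform smallness near a compact slice**: a map continuous on an open set containing
`K × closedBall 0 ρ` (`K` compact) is uniformly close to its values on `K × {0}` near that slice.
[folklore] -/
theorem exists_forall_norm_sub_lt_of_continuousOn {F : Type*} [NormedAddCommGroup F]
    {g : ℂ × ℂ → F} {U : Set (ℂ × ℂ)} {K : Set ℂ} {ρ : ℝ} (hK : IsCompact K) (hρ : 0 < ρ)
    (hsub : K ×ˢ closedBall (0 : ℂ) ρ ⊆ U) (hg : ContinuousOn g U) {κ : ℝ} (hκ : 0 < κ) :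
    ∃ θ : ℝ, 0 < θ ∧ θ ≤ ρ ∧ ∀ b' ∈ K, ∀ η : ℂ, ‖η‖ < θ → ‖g (b', η) - g (b', 0)‖ < κ := by
  have hcpt : IsCompact (K ×ˢ closedBall (0 : ℂ) ρ) := hK.prod (isCompact_closedBall 0 ρ)
  have huc := hcpt.uniformContinuousOn_of_continuous (hg.mono hsub)
  rw [Metric.uniformContinuousOn_iff] at huc
  obtain ⟨θ, hθ, hθP⟩ := huc κ hκ
  refine ⟨min θ ρ, lt_min hθ hρ, min_le_right _ _, fun b' hb' η hη => ?_⟩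
  have hη' : η ∈ closedBall (0 : ℂ) ρ :=
    mem_closedBall_zero_iff.2 (hη.le.trans (min_le_right _ _))
  have h := hθP (b', η) ⟨hb', hη'⟩ (b', 0) ⟨hb', mem_closedBall_self hρ.le⟩ (by
    rw [Prod.dist_eq, dist_self, dist_zero_right]
    exact max_lt_iff.2 ⟨hθ, lt_of_lt_of_le hη (min_le_left _ _)⟩)
  rwa [dist_eq_norm] at h

end Calculus

/-! ### §2 The derivatives of the family at infinity on the exceptional line -/

section Family

variable {M : Type} [TopologicalSpace M] [T2Space M] [CompactSpace M]
  [ChartedSpace (EuclideanSpace ℝ (Fin 4)) M] [IsManifold (𝓡 4) ∞ M]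
  {p : M} {J : ∀ x : punctured p, TangentSpace (𝓡 4) x →L[ℝ] TangentSpace (𝓡 4) x}
  {Floc : ℂ → ℂ → punctured p} {b : ℂ} {δ rI : ℝ}

omit [CompactSpace M] [IsManifold (𝓡 4) ∞ M] in
/-- First value on the exceptional line: `d famXW_{(b', 0)} (c, 0) = (0, c)`. [folklore] -/
theorem fderiv_famXW_inl (hrI : 0 < rI)
    (hSinf : ContDiffOn ℝ ∞ (famXW p Floc) (ball b δ ×ˢ ball 0 rI))
    {b' : ℂ} (hb' : b' ∈ ball b δ) (c : ℂ) :
    fderiv ℝ (famXW p Floc) (b', 0) (c, 0) = (0, c) := by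
  have hDom : IsOpen (ball b δ ×ˢ ball (0 : ℂ) rI) := isOpen_ball.prod isOpen_ball
  have hq : (b', (0 : ℂ)) ∈ ball b δ ×ˢ ball (0 : ℂ) rI := ⟨hb', mem_ball_self hrI⟩
  have hd : HasFDerivAt (famXW p Floc) (fderiv ℝ (famXW p Floc) (b', 0)) (b', 0) :=
    ((hSinf.differentiableOn (by simp)).differentiableAt (hDom.mem_nhds hq)).hasFDerivAt
  have h1 : HasFDerivAt (famXW p Floc ∘ fun b'' : ℂ => (b'', (0 : ℂ)))
      ((fderiv ℝ (famXW p Floc) (b', 0)).comp (ContinuousLinearMap.inl ℝ ℂ ℂ)) b' :=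
    HasFDerivAt.comp b' hd ((hasFDerivAt_id b').prodMk (hasFDerivAt_const (0 : ℂ) b'))
  have h2 : HasFDerivAt (famXW p Floc ∘ fun b'' : ℂ => (b'', (0 : ℂ)))
      (ContinuousLinearMap.inr ℝ ℂ ℂ) b' := by
    have : (famXW p Floc ∘ fun b'' : ℂ => (b'', (0 : ℂ))) = fun b'' => ((0 : ℂ), b'') :=
      funext fun b'' => famXW_zero Floc b''
    rw [this]
    exact (hasFDerivAt_const (0 : ℂ) b').prodMk (hasFDerivAt_id b')
  have h3 := congrArg (fun T : ℂ →L[ℝ] ℂ × ℂ => T c) (h1.unique h2)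
  simpa using h3

omit [CompactSpace M] [IsManifold (𝓡 4) ∞ M] in
/-- Second value on the exceptional line: `(d famXW_{(b', 0)} (0, v)).1 = v` (the member's
coordinate `x' = capX` has complex derivative `1` at `η = 0`). [folklore] -/
theorem fderiv_famXW_inr_fst (hrI : 0 < rI)
    (hmem : ∀ b' ∈ ball b δ, IsPencilPlane J (Floc b') b')
    (hSinf : ContDiffOn ℝ ∞ (famXW p Floc) (ball b δ ×ˢ ball 0 rI))
    {b' : ℂ} (hb' : b' ∈ ball b δ) (v : ℂ) :
    (fderiv ℝ (famXW p Floc) (b', 0) (0, v)).1 = v := by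
  have hDom : IsOpen (ball b δ ×ˢ ball (0 : ℂ) rI) := isOpen_ball.prod isOpen_ball
  have hq : (b', (0 : ℂ)) ∈ ball b δ ×ˢ ball (0 : ℂ) rI := ⟨hb', mem_ball_self hrI⟩
  have hd : HasFDerivAt (famXW p Floc) (fderiv ℝ (famXW p Floc) (b', 0)) (b', 0) :=
    ((hSinf.differentiableOn (by simp)).differentiableAt (hDom.mem_nhds hq)).hasFDerivAt
  have h1 : HasFDerivAt (famXW p Floc ∘ fun η : ℂ => (b', η))
      ((fderiv ℝ (famXW p Floc) (b', 0)).comp (ContinuousLinearMap.inr ℝ ℂ ℂ)) 0 :=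
    HasFDerivAt.comp (0 : ℂ) hd ((hasFDerivAt_const b' (0 : ℂ)).prodMk (hasFDerivAt_id (0 : ℂ)))
  have h2 : HasFDerivAt (Prod.fst ∘ (famXW p Floc ∘ fun η : ℂ => (b', η)))
      ((ContinuousLinearMap.fst ℝ ℂ ℂ).comp
        ((fderiv ℝ (famXW p Floc) (b', 0)).comp (ContinuousLinearMap.inr ℝ ℂ ℂ))) 0 :=
    HasFDerivAt.comp (0 : ℂ) hasFDerivAt_fst h1
  have h3 : HasFDerivAt (Prod.fst ∘ (famXW p Floc ∘ fun η : ℂ => (b', η)))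
      ((ContinuousLinearMap.smulRight (1 : ℂ →L[ℂ] ℂ) (1 : ℂ)).restrictScalars ℝ) 0 := by
    have h := (hmem b' hb').hasDerivAt_inv_fst_zero
    have h' : HasDerivAt (capX p (Floc b')) 1 0 := by rw [capX_eq]; exact h
    exact h'.hasFDerivAt.restrictScalars ℝ
  have h4 := congrArg (fun T : ℂ →L[ℝ] ℂ => T v) (h2.unique h3)
  simpa using h4

omit [CompactSpace M] [IsManifold (𝓡 4) ∞ M] in
/-- **The mixed second derivative of `x' = capX` vanishes on the exceptional line**:
`(d² famXW_{(b', 0)} (c, 0) (0, v)).1 = 0` — differentiate `(d famXW_{(b'', 0)} (0, v)).1 = v`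
in `b''`. [folklore] -/
theorem fderiv_fderiv_famXW_inl_inr_fst (hrI : 0 < rI)
    (hmem : ∀ b' ∈ ball b δ, IsPencilPlane J (Floc b') b')
    (hSinf : ContDiffOn ℝ ∞ (famXW p Floc) (ball b δ ×ˢ ball 0 rI))
    {b' : ℂ} (hb' : b' ∈ ball b δ) (c v : ℂ) :
    (fderiv ℝ (fderiv ℝ (famXW p Floc)) (b', 0) (c, 0) (0, v)).1 = 0 := by
  have hDom : IsOpen (ball b δ ×ˢ ball (0 : ℂ) rI) := isOpen_ball.prod isOpen_ball
  have hq : (b', (0 : ℂ)) ∈ ball b δ ×ˢ ball (0 : ℂ) rI := ⟨hb', mem_ball_self hrI⟩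
  set 𝓓 := fderiv ℝ (famXW p Floc) with h𝓓
  have h𝓓s : ContDiffOn ℝ ∞ 𝓓 (ball b δ ×ˢ ball (0 : ℂ) rI) :=
    hSinf.fderiv_of_isOpen hDom (by simp)
  have hd : HasFDerivAt 𝓓 (fderiv ℝ 𝓓 (b', 0)) (b', 0) :=
    ((h𝓓s.differentiableOn (by simp)).differentiableAt (hDom.mem_nhds hq)).hasFDerivAt
  -- `b'' ↦ 𝓓 (b'', 0) (0, v)` has derivative `c ↦ (d𝓓 (c, 0)) (0, v)`
  have hg : HasFDerivAt (fun b'' : ℂ => 𝓓 (b'', 0))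
      ((fderiv ℝ 𝓓 (b', 0)).comp (ContinuousLinearMap.inl ℝ ℂ ℂ)) b' :=
    HasFDerivAt.comp b' hd ((hasFDerivAt_id b').prodMk (hasFDerivAt_const (0 : ℂ) b'))
  have hh : HasFDerivAt (fun b'' : ℂ => 𝓓 (b'', 0) (0, v))
      (((fderiv ℝ 𝓓 (b', 0)).comp (ContinuousLinearMap.inl ℝ ℂ ℂ)).flip (0, v)) b' := by
    have := hg.clm_apply (hasFDerivAt_const ((0 : ℂ), v) b')
    simpa using this
  have hk : HasFDerivAt (Prod.fst ∘ fun b'' : ℂ => 𝓓 (b'', 0) (0, v))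
      ((ContinuousLinearMap.fst ℝ ℂ ℂ).comp
        (((fderiv ℝ 𝓓 (b', 0)).comp (ContinuousLinearMap.inl ℝ ℂ ℂ)).flip (0, v))) b' :=
    HasFDerivAt.comp b' hasFDerivAt_fst hh
  -- but that first component is the constant `v` near `b'`
  have hk0 : HasFDerivAt (Prod.fst ∘ fun b'' : ℂ => 𝓓 (b'', 0) (0, v)) (0 : ℂ →L[ℝ] ℂ) b' := by
    refine (hasFDerivAt_const v b').congr_of_eventuallyEq ?_
    filter_upwards [isOpen_ball.mem_nhds hb'] with b'' hb''
    exact fderiv_famXW_inr_fst hrI hmem hSinf hb'' v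
  have h := congrArg (fun T : ℂ →L[ℝ] ℂ => T c) (hk.unique hk0)
  simpa using h

omit [CompactSpace M] [IsManifold (𝓡 4) ∞ M] in
/-- By the symmetry of second derivatives also `(d² famXW_{(b', 0)} (0, v) (c, 0)).1 = 0`.
[folklore] -/
theorem fderiv_fderiv_famXW_inr_inl_fst (hrI : 0 < rI)
    (hmem : ∀ b' ∈ ball b δ, IsPencilPlane J (Floc b') b')
    (hSinf : ContDiffOn ℝ ∞ (famXW p Floc) (ball b δ ×ˢ ball 0 rI))
    {b' : ℂ} (hb' : b' ∈ ball b δ) (c v : ℂ) :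
    (fderiv ℝ (fderiv ℝ (famXW p Floc)) (b', 0) (0, v) (c, 0)).1 = 0 := by
  have hDom : IsOpen (ball b δ ×ˢ ball (0 : ℂ) rI) := isOpen_ball.prod isOpen_ball
  have hq : (b', (0 : ℂ)) ∈ ball b δ ×ˢ ball (0 : ℂ) rI := ⟨hb', mem_ball_self hrI⟩
  have hsymm : IsSymmSndFDerivAt ℝ (famXW p Floc) (b', 0) :=
    (hSinf.contDiffAt (hDom.mem_nhds hq)).isSymmSndFDerivAt
      (by rw [minSmoothness_of_isRCLikeNormedField]; exact WithTop.coe_le_coe.2 le_top)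
  rw [hsymm (0, v) (c, 0)]
  exact fderiv_fderiv_famXW_inl_inr_fst hrI hmem hSinf hb' c v

omit [CompactSpace M] [IsManifold (𝓡 4) ∞ M] in
/-- **`∂_{b'} capX = o(η)`, quantitatively**: if `‖d² famXW_{(b'', η')} − d² famXW_{(b'', 0)}‖ ≤ S`
for `‖η'‖ < R` (`R ≤ rI`), then `‖(d famXW_{(b'', η)} (c, 0)).1‖ ≤ S ‖c‖ ‖η‖` for `‖η‖ < R`.
[folklore] -/
theorem norm_fderiv_famXW_inl_fst_le (hrI : 0 < rI)
    (hmem : ∀ b' ∈ ball b δ, IsPencilPlane J (Floc b') b')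
    (hSinf : ContDiffOn ℝ ∞ (famXW p Floc) (ball b δ ×ˢ ball 0 rI))
    {b'' : ℂ} (hb'' : b'' ∈ ball b δ) {R S : ℝ} (hR : R ≤ rI)
    (hS : ∀ η' : ℂ, ‖η'‖ < R →
      ‖fderiv ℝ (fderiv ℝ (famXW p Floc)) (b'', η') -
        fderiv ℝ (fderiv ℝ (famXW p Floc)) (b'', 0)‖ ≤ S)
    (c : ℂ) {η : ℂ} (hη : ‖η‖ < R) :
    ‖(fderiv ℝ (famXW p Floc) (b'', η) (c, 0)).1‖ ≤ S * ‖c‖ * ‖η‖ := by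
  have hDom : IsOpen (ball b δ ×ˢ ball (0 : ℂ) rI) := isOpen_ball.prod isOpen_ball
  set 𝓓 := fderiv ℝ (famXW p Floc) with h𝓓
  have h𝓓s : ContDiffOn ℝ ∞ 𝓓 (ball b δ ×ˢ ball (0 : ℂ) rI) :=
    hSinf.fderiv_of_isOpen hDom (by simp)
  -- the slice `f η' = (𝓓 (b'', η') (c, 0)).1` and its derivative
  set f : ℂ → ℂ := fun η' => (𝓓 (b'', η') (c, 0)).1 with hf
  have hfd : ∀ η' : ℂ, ‖η'‖ < R → HasFDerivAt f
      ((ContinuousLinearMap.fst ℝ ℂ ℂ).comp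
        (((fderiv ℝ 𝓓 (b'', η')).comp (ContinuousLinearMap.inr ℝ ℂ ℂ)).flip (c, 0))) η' := by
    intro η' hη'
    have hq : (b'', η') ∈ ball b δ ×ˢ ball (0 : ℂ) rI :=
      ⟨hb'', mem_ball_zero_iff.2 (lt_of_lt_of_le hη' hR)⟩
    have hd : HasFDerivAt 𝓓 (fderiv ℝ 𝓓 (b'', η')) (b'', η') :=
      ((h𝓓s.differentiableOn (by simp)).differentiableAt (hDom.mem_nhds hq)).hasFDerivAt
    have hg : HasFDerivAt (fun η'' : ℂ => 𝓓 (b'', η''))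
        ((fderiv ℝ 𝓓 (b'', η')).comp (ContinuousLinearMap.inr ℝ ℂ ℂ)) η' :=
      HasFDerivAt.comp η' hd ((hasFDerivAt_const b'' η').prodMk (hasFDerivAt_id η'))
    have hh : HasFDerivAt (fun η'' : ℂ => 𝓓 (b'', η'') (c, 0))
        (((fderiv ℝ 𝓓 (b'', η')).comp (ContinuousLinearMap.inr ℝ ℂ ℂ)).flip (c, 0)) η' := by
      have := hg.clm_apply (hasFDerivAt_const ((c : ℂ), (0 : ℂ)) η')
      simpa using this
    exact HasFDerivAt.comp η' hasFDerivAt_fst hh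
  -- bound on the derivative: the same expression at `η' = 0` vanishes
  have hbound : ∀ η' ∈ ball (0 : ℂ) R, ‖fderiv ℝ f η' - 0‖ ≤ S * ‖c‖ := by
    intro η' hη'
    rw [sub_zero, (hfd η' (mem_ball_zero_iff.1 hη')).fderiv]
    refine ContinuousLinearMap.opNorm_le_bound _ (by
      have := hS η' (mem_ball_zero_iff.1 hη')
      exact mul_nonneg ((norm_nonneg (fderiv ℝ 𝓓 (b'', η') - fderiv ℝ 𝓓 (b'', 0))).trans this)
        (norm_nonneg _)) fun w => ?_
    have hzero : (fderiv ℝ 𝓓 (b'', 0) (0, w) (c, 0)).1 = 0 :=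
      fderiv_fderiv_famXW_inr_inl_fst hrI hmem hSinf hb'' c w
    have heq : ((ContinuousLinearMap.fst ℝ ℂ ℂ).comp
        (((fderiv ℝ 𝓓 (b'', η')).comp (ContinuousLinearMap.inr ℝ ℂ ℂ)).flip (c, 0))) w =
        ((fderiv ℝ 𝓓 (b'', η') - fderiv ℝ 𝓓 (b'', 0)) (0, w) (c, 0)).1 := by
      simp [hzero]
    rw [heq]
    calc ‖((fderiv ℝ 𝓓 (b'', η') - fderiv ℝ 𝓓 (b'', 0)) (0, w) (c, 0)).1‖
        ≤ ‖(fderiv ℝ 𝓓 (b'', η') - fderiv ℝ 𝓓 (b'', 0)) (0, w) (c, 0)‖ := norm_fst_le _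
      _ ≤ ‖(fderiv ℝ 𝓓 (b'', η') - fderiv ℝ 𝓓 (b'', 0)) (0, w)‖ * ‖((c : ℂ), (0 : ℂ))‖ :=
          ContinuousLinearMap.le_opNorm _ _
      _ ≤ ‖fderiv ℝ 𝓓 (b'', η') - fderiv ℝ 𝓓 (b'', 0)‖ * ‖((0 : ℂ), w)‖ * ‖((c : ℂ), (0 : ℂ))‖ :=
          mul_le_mul_of_nonneg_right (ContinuousLinearMap.le_opNorm _ _) (norm_nonneg _)
      _ ≤ S * ‖w‖ * ‖c‖ := by
          have h1 : ‖((0 : ℂ), w)‖ = ‖w‖ := by simp [Prod.norm_def]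
          have h2 : ‖((c : ℂ), (0 : ℂ))‖ = ‖c‖ := by simp [Prod.norm_def]
          rw [h1, h2]
          have := hS η' (mem_ball_zero_iff.1 hη')
          gcongr
      _ = S * ‖c‖ * ‖w‖ := by ring
  have hf0 : f 0 = 0 := by
    simp only [hf]
    rw [h𝓓, fderiv_famXW_inl hrI hSinf hb'' c]
  have hmvt := norm_sub_sub_le_of_fderiv_ball (φ := (0 : ℂ →L[ℝ] ℂ))
    (fun x hx => (hfd x (mem_ball_zero_iff.1 hx)).differentiableAt) hbound
    (mem_ball_zero_iff.2 hη)
  simpa [hf0] using hmvt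

end Family

/-! ### §3 The overlap comparison -/

section Overlap

variable {M : Type} [TopologicalSpace M] [T2Space M] [CompactSpace M]
  [ChartedSpace (EuclideanSpace ℝ (Fin 4)) M] [IsManifold (𝓡 4) ∞ M]
  {p : M} {J : ∀ x : punctured p, TangentSpace (𝓡 4) x →L[ℝ] TangentSpace (𝓡 4) x} {ε : ℝ}

omit [CompactSpace M] [IsManifold (𝓡 4) ∞ M] in
/-- `W = w / z = famW · capX`. [folklore] -/
theorem capW_eq_famW_mul_capX (Floc : ℂ → ℂ → punctured p) (b' η : ℂ) :
    capW p (Floc b') η = (famXW p Floc (b', η)).2 * (famXW p Floc (b', η)).1 := by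
  by_cases hη : η = 0
  · subst hη; simp [famXW, famW]
  · rw [famXW_of_ne_zero Floc hη, capW_of_ne_zero hη, div_eq_mul_inv]

/-- Elementary: `|(1 + a²)⁻¹ − (1 + c²)⁻¹| ≤ |a² − c²|` for `a, c ≥ 0`-free reals. [folklore] -/
theorem abs_inv_one_add_sq_sub_inv_one_add_sq_le (a c : ℝ) :
    |(1 + a ^ 2)⁻¹ - (1 + c ^ 2)⁻¹| ≤ |a ^ 2 - c ^ 2| := by
  have ha : 0 < 1 + a ^ 2 := by positivity
  have hc : 0 < 1 + c ^ 2 := by positivity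
  rw [inv_sub_inv ha.ne' hc.ne', abs_div, abs_of_pos (mul_pos ha hc)]
  rw [div_le_iff₀ (mul_pos ha hc)]
  have h1 : |1 + c ^ 2 - (1 + a ^ 2)| = |a ^ 2 - c ^ 2| := by
    rw [show 1 + c ^ 2 - (1 + a ^ 2) = -(a ^ 2 - c ^ 2) by ring, abs_neg]
  rw [h1]
  have h2 : (1 : ℝ) ≤ (1 + a ^ 2) * (1 + c ^ 2) := by nlinarith [sq_nonneg a, sq_nonneg c, sq_nonneg (a * c)]
  nlinarith [abs_nonneg (a ^ 2 - c ^ 2)]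

/-- Elementary positivity at the end: if `|x' − η| ≤ κ |η|`, `|E| ≤ τ |η|` with
`κ + τ + κ τ < 1`, then `Re (conj x' · (η + E)) > 0` for `η ≠ 0`. [folklore] -/
theorem re_conj_mul_add_pos {x' η E : ℂ} {κ τ : ℝ} (hη : η ≠ 0) (hκ : 0 ≤ κ)
    (hx : ‖x' - η‖ ≤ κ * ‖η‖) (hE : ‖E‖ ≤ τ * ‖η‖) (hsmall : κ + τ + κ * τ < 1) :
    0 < (conj x' * (η + E)).re := by
  have hηpos : 0 < ‖η‖ := norm_pos_iff.2 hη
  have hdecomp : conj x' * (η + E) = (‖η‖ ^ 2 : ℝ) + (conj η * E + conj (x' - η) * η +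
      conj (x' - η) * E) := by
    rw [map_sub]
    have : conj η * η = ((‖η‖ ^ 2 : ℝ) : ℂ) := by
      rw [mul_comm, Complex.mul_conj, Complex.normSq_eq_norm_sq]
    linear_combination this
  rw [hdecomp, Complex.add_re, Complex.ofReal_re]
  have hbound : ‖conj η * E + conj (x' - η) * η + conj (x' - η) * E‖ ≤
      (τ + κ + κ * τ) * ‖η‖ ^ 2 := by
    have h1 : ‖conj η * E‖ ≤ ‖η‖ * (τ * ‖η‖) := by
      rw [norm_mul, Complex.norm_conj]; exact mul_le_mul_of_nonneg_left hE (norm_nonneg _)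
    have h2 : ‖conj (x' - η) * η‖ ≤ κ * ‖η‖ * ‖η‖ := by
      rw [norm_mul, Complex.norm_conj]; exact mul_le_mul_of_nonneg_right hx (norm_nonneg _)
    have h3 : ‖conj (x' - η) * E‖ ≤ κ * ‖η‖ * (τ * ‖η‖) := by
      rw [norm_mul, Complex.norm_conj]
      exact mul_le_mul hx hE (norm_nonneg _) (mul_nonneg hκ (norm_nonneg _))
    have h4 := (norm_add_le _ _).trans (add_le_add ((norm_add_le _ _).trans (add_le_add h1 h2)) h3)
    nlinarith [h4]
  have hre := (Complex.abs_re_le_norm (conj η * E + conj (x' - η) * η + conj (x' - η) * E))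
  have := abs_le.1 (hre.trans hbound)
  nlinarith [this.1, sq_pos_of_pos hηpos]

/-- **Core estimate of the overlap comparison** (pure inequalities). With `W' = V' X'`,
`W = V X`, `σ' = ρ' X̄'`, `σ = ρ X̄` (`ρ' = (1 + |W'|²)⁻¹`, `ρ = (1 + |W|²)⁻¹`), first-order
closeness `|X' − η|, |X − η| ≤ κ|η|`, `|X' − X| ≤ κ|η||d|`, `|V' − V − d| ≤ κ|d|`, bounds
`|V'|, |V| ≤ M` and a `C`-Lipschitz `Ŵ` with `Ŵ σ = W`:
`|W' − Ŵ σ' − d η| ≤ (κ(3 + M) + C(κ + 8M(Mκ + 4)|η|²)) |η| |d|`. [folklore] -/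
theorem overlap_core_estimate {X' V' X V η d Wh' Wh : ℂ} {κ MW CW : ℝ}
    (hκ : 0 ≤ κ) (hκ1 : κ ≤ 1) (hMW1 : 1 ≤ MW) (hCW0 : 0 ≤ CW)
    (hX'η : ‖X' - η‖ ≤ κ * ‖η‖) (hXη : ‖X - η‖ ≤ κ * ‖η‖)
    (hV'le : ‖V'‖ ≤ MW) (hVle : ‖V‖ ≤ MW)
    (hXX : ‖X' - X‖ ≤ κ * ‖η‖ * ‖d‖) (hVV : ‖V' - V - d‖ ≤ κ * ‖d‖)
    (hLip : ‖Wh' - Wh‖ ≤ CW * ‖(((1 + ‖V' * X'‖ ^ 2)⁻¹ : ℝ) : ℂ) * conj X' -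
      (((1 + ‖V * X‖ ^ 2)⁻¹ : ℝ) : ℂ) * conj X‖)
    (hWh : Wh = V * X) :
    ‖V' * X' - Wh' - d * η‖ ≤
      (κ * (3 + MW) + CW * (κ + 8 * MW * (MW * κ + 4) * ‖η‖ ^ 2)) * ‖η‖ * ‖d‖ := by
  have hMW0 : 0 ≤ MW := by linarith
  have hκη : κ * ‖η‖ ≤ ‖η‖ := mul_le_of_le_one_left (norm_nonneg η) hκ1
  have hX'le : ‖X'‖ ≤ 2 * ‖η‖ := by
    have h1 := norm_le_insert' X' η
    linarith
  have hXle : ‖X‖ ≤ 2 * ‖η‖ := by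
    have h1 := norm_le_insert' X η
    linarith
  have hVV' : ‖V' - V‖ ≤ 2 * ‖d‖ := by
    have h1 := norm_le_insert' (V' - V) d
    have h2 : κ * ‖d‖ ≤ ‖d‖ := mul_le_of_le_one_left (norm_nonneg _) hκ1
    linarith
  have hW'le : ‖V' * X'‖ ≤ 2 * MW * ‖η‖ := by
    rw [norm_mul]
    calc ‖V'‖ * ‖X'‖ ≤ MW * (2 * ‖η‖) := mul_le_mul hV'le hX'le (norm_nonneg _) hMW0
      _ = 2 * MW * ‖η‖ := by ring
  have hWle : ‖V * X‖ ≤ 2 * MW * ‖η‖ := by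
    rw [norm_mul]
    calc ‖V‖ * ‖X‖ ≤ MW * (2 * ‖η‖) := mul_le_mul hVle hXle (norm_nonneg _) hMW0
      _ = 2 * MW * ‖η‖ := by ring
  have hWW : ‖V' * X' - V * X‖ ≤ (MW * κ + 4) * ‖η‖ * ‖d‖ := by
    have hdec : V' * X' - V * X = V' * (X' - X) + X * (V' - V) := by ring
    rw [hdec]
    refine (norm_add_le _ _).trans ?_
    rw [norm_mul, norm_mul]
    have h1 : ‖V'‖ * ‖X' - X‖ ≤ MW * (κ * ‖η‖ * ‖d‖) :=
      mul_le_mul hV'le hXX (norm_nonneg _) hMW0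
    have h2 : ‖X‖ * ‖V' - V‖ ≤ 2 * ‖η‖ * (2 * ‖d‖) :=
      mul_le_mul hXle hVV' (norm_nonneg _) (by positivity)
    linarith
  have hWWη : ‖V' * X' - V * X - d * η‖ ≤ κ * (3 + MW) * ‖η‖ * ‖d‖ := by
    have hdec : V' * X' - V * X - d * η =
        (V' - V - d) * X' + d * (X' - η) + V * (X' - X) := by ring
    rw [hdec]
    have h1 : ‖(V' - V - d) * X'‖ ≤ κ * ‖d‖ * (2 * ‖η‖) := by
      rw [norm_mul]; exact mul_le_mul hVV hX'le (norm_nonneg _) (by positivity)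
    have h2 : ‖d * (X' - η)‖ ≤ ‖d‖ * (κ * ‖η‖) := by
      rw [norm_mul]; exact mul_le_mul_of_nonneg_left hX'η (norm_nonneg _)
    have h3 : ‖V * (X' - X)‖ ≤ MW * (κ * ‖η‖ * ‖d‖) := by
      rw [norm_mul]; exact mul_le_mul hVle hXX (norm_nonneg _) hMW0
    have h4 := (norm_add_le _ _).trans (add_le_add ((norm_add_le _ _).trans (add_le_add h1 h2)) h3)
    linarith [h4]
  -- `σ'`, `σ`
  set ρ' : ℝ := (1 + ‖V' * X'‖ ^ 2)⁻¹ with hρ'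
  set ρ : ℝ := (1 + ‖V * X‖ ^ 2)⁻¹ with hρ_def
  have hρ'pos : 0 < ρ' := by positivity
  have hρ'le : ρ' ≤ 1 := inv_le_one_of_one_le₀ (le_add_of_nonneg_right (sq_nonneg _))
  have hρρ' : |ρ' - ρ| ≤ 4 * MW * ‖η‖ * ‖V' * X' - V * X‖ := by
    have h1 := abs_inv_one_add_sq_sub_inv_one_add_sq_le ‖V' * X'‖ ‖V * X‖
    have h2 : |‖V' * X'‖ ^ 2 - ‖V * X‖ ^ 2| ≤ (‖V' * X'‖ + ‖V * X‖) * ‖V' * X' - V * X‖ := by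
      rw [sq_sub_sq, abs_mul, abs_of_nonneg (by positivity)]
      exact mul_le_mul_of_nonneg_left (abs_norm_sub_norm_le _ _) (by positivity)
    have h3 : ‖V' * X'‖ + ‖V * X‖ ≤ 4 * MW * ‖η‖ := by linarith
    exact h1.trans (h2.trans (mul_le_mul_of_nonneg_right h3 (norm_nonneg _)))
  have hσσ : ‖(ρ' : ℂ) * conj X' - (ρ : ℂ) * conj X‖ ≤
      (κ + 8 * MW * (MW * κ + 4) * ‖η‖ ^ 2) * ‖η‖ * ‖d‖ := by
    have hdec : (ρ' : ℂ) * conj X' - (ρ : ℂ) * conj X =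
        (ρ' : ℂ) * (conj X' - conj X) + ((ρ' - ρ : ℝ) : ℂ) * conj X := by
      push_cast; ring
    rw [hdec]
    refine (norm_add_le _ _).trans ?_
    rw [norm_mul, norm_mul, Complex.norm_real, Complex.norm_real, Real.norm_eq_abs,
      Real.norm_eq_abs, abs_of_pos hρ'pos, ← map_sub, Complex.norm_conj, Complex.norm_conj]
    have h1 : ρ' * ‖X' - X‖ ≤ 1 * (κ * ‖η‖ * ‖d‖) :=
      mul_le_mul hρ'le hXX (norm_nonneg _) zero_le_one
    have h2 : |ρ' - ρ| * ‖X‖ ≤ (4 * MW * ‖η‖ * ((MW * κ + 4) * ‖η‖ * ‖d‖)) * (2 * ‖η‖) :=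
      mul_le_mul (hρρ'.trans (mul_le_mul_of_nonneg_left hWW (by positivity))) hXle
        (norm_nonneg _) (by positivity)
    have h3 : (4 * MW * ‖η‖ * ((MW * κ + 4) * ‖η‖ * ‖d‖)) * (2 * ‖η‖) =
        8 * MW * (MW * κ + 4) * ‖η‖ ^ 2 * ‖η‖ * ‖d‖ := by ring
    have h4 : (κ + 8 * MW * (MW * κ + 4) * ‖η‖ ^ 2) * ‖η‖ * ‖d‖ =
        κ * ‖η‖ * ‖d‖ + 8 * MW * (MW * κ + 4) * ‖η‖ ^ 2 * ‖η‖ * ‖d‖ := by ring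
    rw [h4]; rw [h3] at h2; linarith [h1, h2]
  -- conclusion
  have hdec : V' * X' - Wh' - d * η = (V' * X' - V * X - d * η) - (Wh' - Wh) := by
    rw [hWh]; ring
  rw [hdec]
  refine (norm_sub_le _ _).trans ?_
  have h2 := hLip.trans (mul_le_mul_of_nonneg_left hσσ hCW0)
  have h3 : (κ * (3 + MW) + CW * (κ + 8 * MW * (MW * κ + 4) * ‖η‖ ^ 2)) * ‖η‖ * ‖d‖ =
      κ * (3 + MW) * ‖η‖ * ‖d‖ +
        CW * ((κ + 8 * MW * (MW * κ + 4) * ‖η‖ ^ 2) * ‖η‖ * ‖d‖) := by ring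
  rw [h3]
  exact add_le_add hWWη h2

/-- The smallness bookkeeping: with `κ = (64 (M + 3)(C + 1))⁻¹` and
`|η|² ≤ (320 (C + 1)(M + 3))⁻¹` the constant of `overlap_core_estimate` is `≤ 1/4`.
[folklore] -/
theorem overlap_constant_le {κ MW CW t : ℝ} (hMW1 : 1 ≤ MW) (hCW0 : 0 ≤ CW)
    (hκkey : κ * ((MW + 3) * (CW + 1)) = 64⁻¹) (hκ : 0 ≤ κ)
    (ht2 : t ^ 2 ≤ (320 * (CW + 1) * (MW + 3))⁻¹) :
    κ * (3 + MW) + CW * (κ + 8 * MW * (MW * κ + 4) * t ^ 2) ≤ 4⁻¹ := by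
  have hMW0 : 0 ≤ MW := by linarith
  have hp1 : 0 ≤ κ * CW := mul_nonneg hκ hCW0
  have hp2 : 0 ≤ κ * MW := mul_nonneg hκ hMW0
  have hp3 : 0 ≤ κ * MW * CW := mul_nonneg hp2 hCW0
  have hkey' : κ * MW * CW + κ * MW + 3 * (κ * CW) + 3 * κ = 64⁻¹ := by
    rw [← hκkey]; ring
  have hMWκ : MW * κ ≤ 1 := by nlinarith
  have h1 : κ * (3 + MW) + CW * κ ≤ 2 * 64⁻¹ := by nlinarith
  have hMM : MW * (MW * κ) ≤ MW * 1 := mul_le_mul_of_nonneg_left hMWκ hMW0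
  have h3 : 8 * MW * (MW * κ + 4) ≤ 40 * (MW + 3) := by nlinarith
  have h4' : 0 ≤ 8 * MW * (MW * κ + 4) * t ^ 2 := by positivity
  have hq : 0 < 320 * (CW + 1) * (MW + 3) := by positivity
  have h5 : CW * (8 * MW * (MW * κ + 4) * t ^ 2) ≤
      (CW + 1) * (40 * (MW + 3)) * (320 * (CW + 1) * (MW + 3))⁻¹ := by
    calc CW * (8 * MW * (MW * κ + 4) * t ^ 2)
        ≤ (CW + 1) * (8 * MW * (MW * κ + 4) * t ^ 2) :=
          mul_le_mul_of_nonneg_right (by linarith) h4'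
      _ ≤ (CW + 1) * (40 * (MW + 3) * (320 * (CW + 1) * (MW + 3))⁻¹) := by
          apply mul_le_mul_of_nonneg_left _ (by linarith)
          exact mul_le_mul h3 ht2 (sq_nonneg _) (by positivity)
      _ = (CW + 1) * (40 * (MW + 3)) * (320 * (CW + 1) * (MW + 3))⁻¹ := by ring
  have h6 : (CW + 1) * (40 * (MW + 3)) * (320 * (CW + 1) * (MW + 3))⁻¹ = 8⁻¹ := by
    field_simp; ring
  linarith [h1, h5, h6]

omit [CompactSpace M] [IsManifold (𝓡 4) ∞ M] in
set_option maxHeartbeats 800000 in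
/-- **The overlap comparison** (hypothesis `hG` of `IsPencilPlane.eq_of_localFamily`).
Under smoothness of the family across the constraint point (`ContDiffOn ℝ ∞ (famXW p Floc)`
about `(b, 0)`), uniform standard end (`hU`) and a good cap radius `r` of `L = Floc b`, there are
`δ_G ≤ δ` and `η₁ > 0` such that for `‖b' − b‖ < δ_G` and `0 < ‖η‖ ≤ η₁` the cap point
`cap_{b'}(η)` lies in `capDefDom_L` and `π_p (cap_{b'} η) = (b' − b) Λ` with `Re Λ > 0`.
[cite: Wendl2018, Prop. 2.53 with Thm. 2.49] -/
theorem IsPencilPlane.familyOverlap_of_smoothCompactification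
    {Floc : ℂ → ℂ → punctured p} {b : ℂ} {δ : ℝ} (hδ : 0 < δ)
    (hmem : ∀ b' ∈ ball b δ, IsPencilPlane J (Floc b') b')
    {rI : ℝ} (hrI : 0 < rI)
    (hU : ∀ b' ∈ ball b δ, ∀ η : ℂ, η ≠ 0 → ‖η‖ < rI →
      InPuncturedChartBall p ε (Floc b' η⁻¹) ∧ 1 < ‖(pencilCoord p (Floc b' η⁻¹)).1‖)
    (hSinf : ContDiffOn ℝ ∞ (famXW p Floc) (ball b δ ×ˢ ball 0 rI))
    {r : ℝ} (hr : 0 < r)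
    (hσ : ContDiffOn ℝ ∞ (capFst p (Floc b)) (ball 0 r))
    (hWr : ContDiffOn ℝ ∞ (capW p (Floc b)) (ball 0 r))
    (hinjσ : InjOn (capFst p (Floc b)) (ball 0 r))
    (hbij : ∀ η ∈ ball (0 : ℂ) r, Bijective (fderiv ℝ (capFst p (Floc b)) η)) :
    ∃ δG η₁ : ℝ, 0 < δG ∧ δG ≤ δ ∧ 0 < η₁ ∧
      ∀ b' ∈ ball b δG, ∀ η : ℂ, 0 < ‖η‖ → ‖η‖ ≤ η₁ →
        pencilCap p (Floc b') η ∈ capDefDom p (Floc b) r ∧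
        ∃ Λ : ℂ, 0 < Λ.re ∧
          capDefFn p (Floc b) r (pencilCap p (Floc b') η) = (b' - b) * Λ := by
  set L : ℂ → punctured p := Floc b with hL_def
  set box : Set (ℂ × ℂ) := ball b δ ×ˢ ball (0 : ℂ) rI with hbox
  have hDom : IsOpen box := isOpen_ball.prod isOpen_ball
  set 𝓓 := fderiv ℝ (famXW p Floc) with h𝓓
  set 𝓓₂ := fderiv ℝ 𝓓 with h𝓓₂
  have h𝓓c : ContinuousOn 𝓓 box := hSinf.continuousOn_fderiv_of_isOpen hDom (by simp)
  have h𝓓s : ContDiffOn ℝ ∞ 𝓓 box := hSinf.fderiv_of_isOpen hDom (by simp)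
  have h𝓓₂c : ContinuousOn 𝓓₂ box := h𝓓s.continuousOn_fderiv_of_isOpen hDom (by simp)
  have hdiff : ∀ q ∈ box, HasFDerivAt (famXW p Floc) (𝓓 q) q := fun q hq =>
    ((hSinf.differentiableOn (by simp)).differentiableAt (hDom.mem_nhds hq)).hasFDerivAt
  /- `Ŵ = capSlope` of `L` is Lipschitz near `0` -/
  set Ŵ := capSlope p L r with hŴ_def
  set OW : Set ℂ := capFst p L '' ball 0 r with hOW_def
  have hOW : IsOpen OW := isOpen_image_capFst hσ hbij
  have h0OW : (0 : ℂ) ∈ OW := ⟨0, mem_ball_self hr, capFst_zero⟩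
  have hŴs : ContDiffOn ℝ ∞ Ŵ OW := contDiffOn_capSlope hσ hWr hinjσ hbij
  obtain ⟨ρW, hρW, hρWsub⟩ : ∃ ρW : ℝ, 0 < ρW ∧ closedBall (0 : ℂ) ρW ⊆ OW := by
    obtain ⟨ρ, hρ, hρsub⟩ := Metric.isOpen_iff.1 hOW 0 h0OW
    exact ⟨ρ / 2, half_pos hρ, (closedBall_subset_ball (by linarith)).trans hρsub⟩
  have hŴdc : ContinuousOn (fderiv ℝ Ŵ) OW := hŴs.continuousOn_fderiv_of_isOpen hOW (by simp)
  obtain ⟨CW, hCW⟩ := (isCompact_closedBall (0 : ℂ) ρW).exists_bound_of_continuousOn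
    (hŴdc.mono hρWsub)
  have hCW0 : 0 ≤ CW := le_trans (norm_nonneg _) (hCW 0 (mem_closedBall_self hρW.le))
  have hLipW : ∀ x ∈ ball (0 : ℂ) ρW, ∀ y ∈ ball (0 : ℂ) ρW, ‖Ŵ x - Ŵ y‖ ≤ CW * ‖x - y‖ :=
    fun x hx y hy => (convex_ball (0 : ℂ) ρW).norm_image_sub_le_of_norm_fderiv_le
      (fun z hz => (hŴs.differentiableOn (by simp)).differentiableAt
        (hOW.mem_nhds (hρWsub (ball_subset_closedBall hz))))
      (fun z hz => hCW z (ball_subset_closedBall hz)) hy hx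
  /- compact parameter set, bound `B` for `d famXW` -/
  set K : Set ℂ := closedBall b (δ / 2) with hK_def
  have hK : IsCompact K := isCompact_closedBall _ _
  have hKδ : K ⊆ ball b δ := closedBall_subset_ball (by linarith)
  have hsub : K ×ˢ closedBall (0 : ℂ) (rI / 2) ⊆ box :=
    prod_mono hKδ (closedBall_subset_ball (by linarith))
  obtain ⟨B0, hB0⟩ := (hK.prod (isCompact_closedBall (0 : ℂ) (rI / 2))).exists_bound_of_continuousOn
    (h𝓓c.mono hsub)
  set B : ℝ := max B0 1 with hB_def
  have hB1 : 1 ≤ B := le_max_right _ _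
  have hB0B : B0 ≤ B := le_max_left _ _
  set MW : ℝ := ‖b‖ + δ + B * rI + 1 with hMW_def
  have hBrI : 0 ≤ B * rI := mul_nonneg (by linarith) hrI.le
  have hMW1 : 1 ≤ MW := by rw [hMW_def]; linarith [norm_nonneg b]
  /- the small parameter `κ` and the radii -/
  set κ : ℝ := (64 * (MW + 3) * (CW + 1))⁻¹ with hκ_def
  have hden : 0 < 64 * (MW + 3) * (CW + 1) := by positivity
  have hκ : 0 < κ := inv_pos.2 hden
  have hκ1 : κ ≤ 1 := inv_le_one_of_one_le₀ (by nlinarith)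
  have hκkey : κ * ((MW + 3) * (CW + 1)) = 64⁻¹ := by
    rw [hκ_def]; field_simp
  obtain ⟨θ₁, hθ₁, hθ₁ρ, hθ₁P⟩ :=
    exists_forall_norm_sub_lt_of_continuousOn hK (half_pos hrI) hsub h𝓓c hκ
  obtain ⟨θ₂, hθ₂, hθ₂ρ, hθ₂P⟩ :=
    exists_forall_norm_sub_lt_of_continuousOn (F := ℂ × ℂ →L[ℝ] (ℂ × ℂ →L[ℝ] ℂ × ℂ))
      hK (half_pos hrI) hsub (by exact h𝓓₂c) hκ
  set ηq : ℝ := (320 * (CW + 1) * (MW + 3))⁻¹ with hηq_def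
  have hηq : 0 < ηq := by positivity
  have hηq1 : ηq ≤ 1 := inv_le_one_of_one_le₀ (by nlinarith)
  set η₁ : ℝ := min (min (min θ₁ θ₂) (min r ρW)) ηq / 4 with hη₁_def
  have hmin : 0 < min (min (min θ₁ θ₂) (min r ρW)) ηq :=
    lt_min (lt_min (lt_min hθ₁ hθ₂) (lt_min hr hρW)) hηq
  have hη₁ : 0 < η₁ := by rw [hη₁_def]; linarith
  have hm1 := min_le_left (min (min θ₁ θ₂) (min r ρW)) ηq
  have hm2 := min_le_right (min (min θ₁ θ₂) (min r ρW)) ηq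
  have hm3 := min_le_left (min θ₁ θ₂) (min r ρW)
  have hm4 := min_le_right (min θ₁ θ₂) (min r ρW)
  have hm5 := min_le_left θ₁ θ₂
  have hm6 := min_le_right θ₁ θ₂
  have hm7 := min_le_left r ρW
  have hm8 := min_le_right r ρW
  have hη₁θ₁ : 4 * η₁ ≤ θ₁ := by rw [hη₁_def]; linarith
  have hη₁θ₂ : 4 * η₁ ≤ θ₂ := by rw [hη₁_def]; linarith
  have hη₁r : 4 * η₁ ≤ r := by rw [hη₁_def]; linarith
  have hη₁ρW : 4 * η₁ ≤ ρW := by rw [hη₁_def]; linarith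
  have hη₁q : 4 * η₁ ≤ ηq := by rw [hη₁_def]; linarith
  refine ⟨δ / 2, η₁, half_pos hδ, by linarith, hη₁, fun b' hb' η hη0 hηle => ?_⟩
  /- ── the estimates ── -/
  have hη0' : η ≠ 0 := norm_pos_iff.1 hη0
  have hηθ₁ : ‖η‖ < θ₁ := by linarith
  have hηθ₂ : ‖η‖ < θ₂ := by linarith
  have hηr : ‖η‖ < r := by linarith
  have hηrI : ‖η‖ < rI / 2 := lt_of_lt_of_le hηθ₁ hθ₁ρ
  have hηrI' : ‖η‖ < rI := by linarith
  have hηq' : ‖η‖ ≤ ηq := by linarith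
  have hη1 : ‖η‖ ≤ 1 := hηq'.trans hηq1
  have hηρW : 2 * ‖η‖ < ρW := by linarith
  have hb'K : b' ∈ K := ball_subset_closedBall hb'
  have hbK : b ∈ K := mem_closedBall_self (by linarith)
  have hb'δ : b' ∈ ball b δ := hKδ hb'K
  have hb'n : ‖b'‖ ≤ ‖b‖ + δ := by
    have h1 : dist b' b ≤ δ / 2 := hb'K
    rw [dist_eq_norm] at h1
    linarith [norm_le_insert' b' b, norm_sub_rev b' b]
  -- (E0)/(E1): slices in `η`
  have hslice : ∀ c₀ ∈ K,
      ‖(famXW p Floc (c₀, η)).1 - η‖ ≤ κ * ‖η‖ ∧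
      ‖(famXW p Floc (c₀, η)).2 - c₀‖ ≤ B * ‖η‖ := by
    intro c₀ hc₀
    have hc₀δ : c₀ ∈ ball b δ := hKδ hc₀
    have hsd : ∀ η' : ℂ, ‖η'‖ < rI / 2 → HasFDerivAt (fun t : ℂ => famXW p Floc (c₀, t))
        ((𝓓 (c₀, η')).comp (ContinuousLinearMap.inr ℝ ℂ ℂ)) η' := fun η' hη' =>
      HasFDerivAt.comp η' (hdiff _ ⟨hc₀δ, mem_ball_zero_iff.2 (by linarith)⟩)
        ((hasFDerivAt_const c₀ η').prodMk (hasFDerivAt_id η'))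
    constructor
    · have hf : ∀ η' : ℂ, ‖η'‖ < rI / 2 →
          HasFDerivAt (Prod.fst ∘ fun t : ℂ => famXW p Floc (c₀, t))
            ((ContinuousLinearMap.fst ℝ ℂ ℂ).comp
              ((𝓓 (c₀, η')).comp (ContinuousLinearMap.inr ℝ ℂ ℂ))) η' :=
        fun η' hη' => HasFDerivAt.comp η' hasFDerivAt_fst (hsd η' hη')
      have hbound : ∀ η' ∈ ball (0 : ℂ) (min θ₁ (rI / 2)),
          ‖fderiv ℝ (Prod.fst ∘ fun t : ℂ => famXW p Floc (c₀, t)) η' -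
            ContinuousLinearMap.id ℝ ℂ‖ ≤ κ := by
        intro η' hη'
        have hη'1 : ‖η'‖ < θ₁ := lt_of_lt_of_le (mem_ball_zero_iff.1 hη') (min_le_left _ _)
        have hη'2 : ‖η'‖ < rI / 2 := lt_of_lt_of_le (mem_ball_zero_iff.1 hη') (min_le_right _ _)
        rw [(hf η' hη'2).fderiv]
        refine ContinuousLinearMap.opNorm_le_bound _ hκ.le fun w => ?_
        have hw0 : (𝓓 (c₀, 0) (0, w)).1 = w := fderiv_famXW_inr_fst hrI hmem hSinf hc₀δ w
        have heq : ((ContinuousLinearMap.fst ℝ ℂ ℂ).comp ((𝓓 (c₀, η')).comp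
            (ContinuousLinearMap.inr ℝ ℂ ℂ)) - ContinuousLinearMap.id ℝ ℂ) w =
            ((𝓓 (c₀, η') - 𝓓 (c₀, 0)) (0, w)).1 := by
          simp [hw0]
        rw [heq]
        calc ‖((𝓓 (c₀, η') - 𝓓 (c₀, 0)) (0, w)).1‖ ≤ ‖(𝓓 (c₀, η') - 𝓓 (c₀, 0)) (0, w)‖ :=
              norm_fst_le _
          _ ≤ ‖𝓓 (c₀, η') - 𝓓 (c₀, 0)‖ * ‖((0 : ℂ), w)‖ := ContinuousLinearMap.le_opNorm _ _
          _ ≤ κ * ‖w‖ := by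
              have h1 : ‖((0 : ℂ), w)‖ = ‖w‖ := by simp [Prod.norm_def]
              rw [h1]
              exact mul_le_mul_of_nonneg_right (hθ₁P c₀ hc₀ η' hη'1).le (norm_nonneg _)
      have hmvt := norm_sub_sub_le_of_fderiv_ball (φ := ContinuousLinearMap.id ℝ ℂ)
        (fun x hx => (hf x (lt_of_lt_of_le (mem_ball_zero_iff.1 hx) (min_le_right _ _))).differentiableAt)
        hbound (mem_ball_zero_iff.2 (lt_min hηθ₁ hηrI))
      simpa [famXW_zero] using hmvt
    · have hf : ∀ η' : ℂ, ‖η'‖ < rI / 2 →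
          HasFDerivAt (Prod.snd ∘ fun t : ℂ => famXW p Floc (c₀, t))
            ((ContinuousLinearMap.snd ℝ ℂ ℂ).comp
              ((𝓓 (c₀, η')).comp (ContinuousLinearMap.inr ℝ ℂ ℂ))) η' :=
        fun η' hη' => HasFDerivAt.comp η' hasFDerivAt_snd (hsd η' hη')
      have hbound : ∀ η' ∈ ball (0 : ℂ) (rI / 2),
          ‖fderiv ℝ (Prod.snd ∘ fun t : ℂ => famXW p Floc (c₀, t)) η' - 0‖ ≤ B := by
        intro η' hη'
        have hη'2 : ‖η'‖ < rI / 2 := mem_ball_zero_iff.1 hη'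
        rw [(hf η' hη'2).fderiv, sub_zero]
        refine ContinuousLinearMap.opNorm_le_bound _ (by linarith) fun w => ?_
        calc ‖((ContinuousLinearMap.snd ℝ ℂ ℂ).comp ((𝓓 (c₀, η')).comp
              (ContinuousLinearMap.inr ℝ ℂ ℂ))) w‖ = ‖(𝓓 (c₀, η') (0, w)).2‖ := by simp
          _ ≤ ‖𝓓 (c₀, η') (0, w)‖ := norm_snd_le _
          _ ≤ ‖𝓓 (c₀, η')‖ * ‖((0 : ℂ), w)‖ := ContinuousLinearMap.le_opNorm _ _
          _ ≤ B * ‖w‖ := by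
              have h1 : ‖((0 : ℂ), w)‖ = ‖w‖ := by simp [Prod.norm_def]
              rw [h1]
              refine mul_le_mul_of_nonneg_right ?_ (norm_nonneg _)
              exact (hB0 (c₀, η') ⟨hc₀, mem_closedBall_zero_iff.2 hη'2.le⟩).trans hB0B
      have hmvt := norm_sub_sub_le_of_fderiv_ball (φ := (0 : ℂ →L[ℝ] ℂ))
        (fun x hx => (hf x (mem_ball_zero_iff.1 hx)).differentiableAt) hbound
        (mem_ball_zero_iff.2 hηrI)
      simpa [famXW_zero] using hmvt
  -- (E2)/(E3): variation in the family parameter at fixed `η`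
  have hvar : ‖(famXW p Floc (b', η)).1 - (famXW p Floc (b, η)).1‖ ≤ κ * ‖η‖ * ‖b' - b‖ ∧
      ‖(famXW p Floc (b', η)).2 - (famXW p Floc (b, η)).2 - (b' - b)‖ ≤ κ * ‖b' - b‖ := by
    have hgd : ∀ c₀ ∈ ball b (δ / 2), HasFDerivAt (fun t : ℂ => famXW p Floc (t, η))
        ((𝓓 (c₀, η)).comp (ContinuousLinearMap.inl ℝ ℂ ℂ)) c₀ := fun c₀ hc₀ =>
      HasFDerivAt.comp c₀ (hdiff _ ⟨hKδ (ball_subset_closedBall hc₀), mem_ball_zero_iff.2 hηrI'⟩)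
        ((hasFDerivAt_id c₀).prodMk (hasFDerivAt_const η c₀))
    constructor
    · have hf : ∀ c₀ ∈ ball b (δ / 2),
          HasFDerivAt (Prod.fst ∘ fun t : ℂ => famXW p Floc (t, η))
            ((ContinuousLinearMap.fst ℝ ℂ ℂ).comp
              ((𝓓 (c₀, η)).comp (ContinuousLinearMap.inl ℝ ℂ ℂ))) c₀ :=
        fun c₀ hc₀ => HasFDerivAt.comp c₀ hasFDerivAt_fst (hgd c₀ hc₀)
      have hbound : ∀ c₀ ∈ ball b (δ / 2),
          ‖fderiv ℝ (Prod.fst ∘ fun t : ℂ => famXW p Floc (t, η)) c₀‖ ≤ κ * ‖η‖ := by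
        intro c₀ hc₀
        rw [(hf c₀ hc₀).fderiv]
        refine ContinuousLinearMap.opNorm_le_bound _ (by positivity) fun c => ?_
        have hS : ∀ η' : ℂ, ‖η'‖ < min θ₂ rI →
            ‖fderiv ℝ (fderiv ℝ (famXW p Floc)) (c₀, η') -
              fderiv ℝ (fderiv ℝ (famXW p Floc)) (c₀, 0)‖ ≤ κ := fun η' hη' =>
          (hθ₂P c₀ (ball_subset_closedBall hc₀) η'
            (lt_of_lt_of_le hη' (min_le_left _ _))).le
        have h := norm_fderiv_famXW_inl_fst_le hrI hmem hSinf (hKδ (ball_subset_closedBall hc₀))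
          (min_le_right θ₂ rI) hS c (lt_min hηθ₂ hηrI')
        calc ‖((ContinuousLinearMap.fst ℝ ℂ ℂ).comp ((𝓓 (c₀, η)).comp
              (ContinuousLinearMap.inl ℝ ℂ ℂ))) c‖ = ‖(𝓓 (c₀, η) (c, 0)).1‖ := by simp
          _ ≤ κ * ‖c‖ * ‖η‖ := h
          _ = κ * ‖η‖ * ‖c‖ := by ring
      have := (convex_ball b (δ / 2)).norm_image_sub_le_of_norm_fderiv_le
        (fun x hx => (hf x hx).differentiableAt) hbound (mem_ball_self (half_pos hδ)) hb'
      simpa using this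
    · have hf : ∀ c₀ ∈ ball b (δ / 2),
          HasFDerivAt (Prod.snd ∘ fun t : ℂ => famXW p Floc (t, η))
            ((ContinuousLinearMap.snd ℝ ℂ ℂ).comp
              ((𝓓 (c₀, η)).comp (ContinuousLinearMap.inl ℝ ℂ ℂ))) c₀ :=
        fun c₀ hc₀ => HasFDerivAt.comp c₀ hasFDerivAt_snd (hgd c₀ hc₀)
      have hbound : ∀ c₀ ∈ ball b (δ / 2),
          ‖fderiv ℝ (Prod.snd ∘ fun t : ℂ => famXW p Floc (t, η)) c₀ -
            ContinuousLinearMap.id ℝ ℂ‖ ≤ κ := by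
        intro c₀ hc₀
        have hc₀K : c₀ ∈ K := ball_subset_closedBall hc₀
        rw [(hf c₀ hc₀).fderiv]
        refine ContinuousLinearMap.opNorm_le_bound _ hκ.le fun c => ?_
        have hc0 : (𝓓 (c₀, 0) (c, 0)).2 = c := by
          rw [h𝓓, fderiv_famXW_inl hrI hSinf (hKδ hc₀K) c]
        have heq : ((ContinuousLinearMap.snd ℝ ℂ ℂ).comp ((𝓓 (c₀, η)).comp
            (ContinuousLinearMap.inl ℝ ℂ ℂ)) - ContinuousLinearMap.id ℝ ℂ) c =
            ((𝓓 (c₀, η) - 𝓓 (c₀, 0)) (c, 0)).2 := by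
          simp [hc0]
        rw [heq]
        calc ‖((𝓓 (c₀, η) - 𝓓 (c₀, 0)) (c, 0)).2‖ ≤ ‖(𝓓 (c₀, η) - 𝓓 (c₀, 0)) (c, 0)‖ :=
              norm_snd_le _
          _ ≤ ‖𝓓 (c₀, η) - 𝓓 (c₀, 0)‖ * ‖((c : ℂ), (0 : ℂ))‖ := ContinuousLinearMap.le_opNorm _ _
          _ ≤ κ * ‖c‖ := by
              have h1 : ‖((c : ℂ), (0 : ℂ))‖ = ‖c‖ := by simp [Prod.norm_def]
              rw [h1]
              exact mul_le_mul_of_nonneg_right (hθ₁P c₀ hc₀K η hηθ₁).le (norm_nonneg _)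
      have := (convex_ball b (δ / 2)).norm_image_sub_le_of_norm_fderiv_le'
        (fun x hx => (hf x hx).differentiableAt) hbound (mem_ball_self (half_pos hδ)) hb'
      simpa using this
  /- ── apply the core estimate ── -/
  obtain ⟨hX'η, hV'b⟩ := hslice b' hb'K
  obtain ⟨hXη, hVb⟩ := hslice b hbK
  obtain ⟨hXX, hVV⟩ := hvar
  have hBη : B * ‖η‖ ≤ B * rI := mul_le_mul_of_nonneg_left hηrI'.le (by linarith)
  have hV'le : ‖(famXW p Floc (b', η)).2‖ ≤ MW := by
    have h1 := norm_le_insert' (famXW p Floc (b', η)).2 b'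
    rw [hMW_def]; linarith
  have hVle : ‖(famXW p Floc (b, η)).2‖ ≤ MW := by
    have h1 := norm_le_insert' (famXW p Floc (b, η)).2 b
    rw [hMW_def]; linarith [hδ.le]
  have hκη : κ * ‖η‖ ≤ ‖η‖ := mul_le_of_le_one_left (norm_nonneg η) hκ1
  have hX'le : ‖(famXW p Floc (b', η)).1‖ ≤ 2 * ‖η‖ := by
    have h1 := norm_le_insert' (famXW p Floc (b', η)).1 η
    linarith
  have hXle : ‖(famXW p Floc (b, η)).1‖ ≤ 2 * ‖η‖ := by
    have h1 := norm_le_insert' (famXW p Floc (b, η)).1 η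
    linarith
  -- `W`, `σ` in terms of `famXW`
  have hW' : capW p (Floc b') η = (famXW p Floc (b', η)).2 * (famXW p Floc (b', η)).1 :=
    capW_eq_famW_mul_capX Floc b' η
  have hW : capW p L η = (famXW p Floc (b, η)).2 * (famXW p Floc (b, η)).1 :=
    capW_eq_famW_mul_capX Floc b η
  have hσ'eq : capFst p (Floc b') η =
      (((1 + ‖(famXW p Floc (b', η)).2 * (famXW p Floc (b', η)).1‖ ^ 2)⁻¹ : ℝ) : ℂ) *
        conj (famXW p Floc (b', η)).1 := by
    rw [capFst_eq, Complex.real_smul, hW']; rfl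
  have hσeq : capFst p L η =
      (((1 + ‖(famXW p Floc (b, η)).2 * (famXW p Floc (b, η)).1‖ ^ 2)⁻¹ : ℝ) : ℂ) *
        conj (famXW p Floc (b, η)).1 := by
    rw [capFst_eq, Complex.real_smul, hW]; rfl
  have hσ'le : ‖capFst p (Floc b') η‖ ≤ 2 * ‖η‖ := by
    rw [hσ'eq, norm_mul, Complex.norm_real, Real.norm_eq_abs, abs_of_pos (by positivity),
      Complex.norm_conj]
    calc _ ≤ 1 * (2 * ‖η‖) := mul_le_mul (inv_le_one_of_one_le₀
          (le_add_of_nonneg_right (sq_nonneg _))) hX'le (norm_nonneg _) zero_le_one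
      _ = 2 * ‖η‖ := one_mul _
  have hσle : ‖capFst p L η‖ ≤ 2 * ‖η‖ := by
    rw [hσeq, norm_mul, Complex.norm_real, Real.norm_eq_abs, abs_of_pos (by positivity),
      Complex.norm_conj]
    calc _ ≤ 1 * (2 * ‖η‖) := mul_le_mul (inv_le_one_of_one_le₀
          (le_add_of_nonneg_right (sq_nonneg _))) hXle (norm_nonneg _) zero_le_one
      _ = 2 * ‖η‖ := one_mul _
  have hσ'ball : capFst p (Floc b') η ∈ ball (0 : ℂ) ρW :=
    mem_ball_zero_iff.2 (lt_of_le_of_lt hσ'le hηρW)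
  have hσball : capFst p L η ∈ ball (0 : ℂ) ρW :=
    mem_ball_zero_iff.2 (lt_of_le_of_lt hσle hηρW)
  have hWσ : Ŵ (capFst p L η) = capW p L η := capSlope_capFst hinjσ (mem_ball_zero_iff.2 hηr)
  -- the core estimate
  have hLip' := hLipW _ hσ'ball _ hσball
  rw [hσ'eq, hσeq] at hLip'
  have hcore := overlap_core_estimate (d := b' - b) hκ.le hκ1 hMW1 hCW0 hX'η hXη hV'le hVle
    hXX hVV hLip' (by rw [← hσeq, hWσ, hW])
  rw [← hW'] at hcore
  set g : ℂ := capW p (Floc b') η - Ŵ (capFst p (Floc b') η) with hg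
  set τ : ℝ := κ * (3 + MW) + CW * (κ + 8 * MW * (MW * κ + 4) * ‖η‖ ^ 2) with hτ
  have hgest : ‖g - (b' - b) * η‖ ≤ τ * ‖η‖ * ‖b' - b‖ := hcore
  have hτle : τ ≤ 4⁻¹ :=
    overlap_constant_le hMW1 hCW0 hκkey hκ.le
      (by nlinarith only [hηq', hη1, norm_nonneg η])
  /- membership and the factorisation -/
  have hU' : ∀ η' : ℂ, η' ≠ 0 → ‖η'‖ < rI →
      InPuncturedChartBall p ε (Floc b' η'⁻¹) ∧ 1 < ‖(pencilCoord p (Floc b' η'⁻¹)).1‖ :=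
    fun η' h1 h2 => hU b' hb'δ η' h1 h2
  have hpair := IsPencilPlane.flatPair_pencilCap (p := p) (u := Floc b') hU' (mem_ball_zero_iff.2 hηrI')
  refine ⟨⟨hpair.1, ?_⟩, ?_⟩
  · rw [hpair.2]
    exact hρWsub (ball_subset_closedBall hσ'ball)
  · have hfac : capDefFn p L r (pencilCap p (Floc b') η) = capFst p (Floc b') η * g :=
      IsPencilPlane.capDefFn_pencilCap_eq (p := p) (u := L) (u' := Floc b') hU'
        (mem_ball_zero_iff.2 hηrI')
    by_cases hbb : b' = b
    · refine ⟨1, by simp, ?_⟩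
      have hg0 : g = 0 := by
        have : capW p (Floc b') η - Ŵ (capFst p (Floc b') η) = 0 := by
          rw [hbb]
          change capW p L η - Ŵ (capFst p L η) = 0
          rw [hWσ, sub_self]
        exact this
      rw [hfac, hg0, hbb]; simp
    · have hbb' : b' - b ≠ 0 := sub_ne_zero.2 hbb
      refine ⟨capFst p (Floc b') η * g / (b' - b), ?_, by rw [hfac]; field_simp⟩
      set E : ℂ := (g - (b' - b) * η) / (b' - b) with hE
      have hgE : g / (b' - b) = η + E := by rw [hE]; field_simp; ring
      have hEle : ‖E‖ ≤ 4⁻¹ * ‖η‖ := by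
        rw [hE, norm_div, div_le_iff₀ (norm_pos_iff.2 hbb')]
        calc ‖g - (b' - b) * η‖ ≤ τ * ‖η‖ * ‖b' - b‖ := hgest
          _ ≤ 4⁻¹ * ‖η‖ * ‖b' - b‖ := by gcongr
      have hρ'pos : (0 : ℝ) < (1 + ‖(famXW p Floc (b', η)).2 * (famXW p Floc (b', η)).1‖ ^ 2)⁻¹ := by
        positivity
      have hΛ : capFst p (Floc b') η * g / (b' - b) =
          (((1 + ‖(famXW p Floc (b', η)).2 * (famXW p Floc (b', η)).1‖ ^ 2)⁻¹ : ℝ) : ℂ) *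
            (conj (famXW p Floc (b', η)).1 * (η + E)) := by
        rw [mul_div_assoc, hgE, hσ'eq]; ring
      rw [hΛ, Complex.re_ofReal_mul]
      refine mul_pos hρ'pos (re_conj_mul_add_pos hη0' hκ.le hX'η hEle ?_)
      have hMW0 : 0 ≤ MW := le_trans zero_le_one hMW1
      have hp1 : 0 ≤ κ * CW := mul_nonneg hκ.le hCW0
      have hp2 : 0 ≤ κ * MW := mul_nonneg hκ.le hMW0
      have hp3 : 0 ≤ κ * MW * CW := mul_nonneg hp2 hCW0
      have hkey' : κ * MW * CW + κ * MW + 3 * (κ * CW) + 3 * κ = 64⁻¹ := by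
        rw [← hκkey]; ring
      have hκs : κ ≤ 64⁻¹ := by linarith only [hkey', hp1, hp2, hp3]
      linarith only [hκs]

end Overlap

end Literature.Geometry.Symplectic
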